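import Mathlib

/-!
# R-T rung, `J₅`, `μ₂`-vertex: the lifted action and the deck involution EXIST as automorphisms of `k[s, Y₀,…,Y₄, passengers]`

(crux stmt-ResolutionOfSingularities-15640 `WildQuotients.WildQuotientResolution`, line `Sketch`,
sector `|G| = p`; RUNG V5 of `L/w45c/CHAIN.md` v8.1, brick B7/`HP₂` step (α) part 2b′ (companion of
`…Mu2CoverAction`, whose theorems take `σ_U`, `τ` ABSTRACTLY by their laws; design
res-L1-w45c-idea-2 `W2-DESIGN.md` §6 = res-type-036 PROPOSAL 2026-08-27T11:25:02Z, kit j277185);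
twin of res-L1-w45c-stub-1's `…JordanFourRootChart0Action`. [OURS · L1 W4.5c] — NOT a statement of
any manuscript; replaces the role of no printed item. Prover res-type-036. Def-free; Mathlib only.)

On `A = MvPolynomial (Option (Fin n)) k` (`s = X none`, `Yᵢ = X (some ·)` on the slots `a,…,e`):
* `exists_coverSigma` — a `k`-algebra automorphism `σ_U` with `s ↦ s`, `Y₁ ↦ Y₁ + sY₀`,
  `Y₂ ↦ Y₂ + sY₁`, `Y₃ ↦ Y₃ + sY₂`, `Y₄ ↦ Y₄ + sY₃`, every other variable fixed (inverse:
  `Y_j ↦ Σᵢ (−s)ⁱ Y_{j−i}`);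
* `exists_coverTau` — a `k`-algebra involution `τ` with `s, Y₁, Y₃ ↦ −s, −Y₁, −Y₃`, every other
  variable fixed.
-/

-- single-problem summit: the doubled namespace component `ResolutionOfSingularities` is forced
set_option linter.dupNamespace false

noncomputable section

open MvPolynomial

namespace Summit.ResolutionOfSingularities.ResolutionOfSingularities.Theorems.WildQuotientResolution.JordanFive

variable (k : Type) [Field k] (n : ℕ) (a b c d e : Fin n)

/-! ## Existence of the two automorphisms -/

/-- **The cover action exists as a `k`-algebra automorphism** of `k[s, Y, pass]`: the triangular
substitution `Y₁ ↦ Y₁ + sY₀, …, Y₄ ↦ Y₄ + sY₃` with inverse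
`Y_j ↦ Σᵢ (−s)ⁱ Y_{j−i}`. [OURS · L1 W4.5c] -/
theorem exists_coverSigma (hab : a ≠ b) (hac : a ≠ c) (had : a ≠ d) (hae : a ≠ e) (hbc : b ≠ c)
    (hbd : b ≠ d) (hbe : b ≠ e) (hcd : c ≠ d) (hce : c ≠ e) (hde : d ≠ e) :
    ∃ σU : MvPolynomial (Option (Fin n)) k ≃ₐ[k] MvPolynomial (Option (Fin n)) k,
      σU (X none) = X none ∧
      σU (X (some b)) = X (some b) + X none * X (some a) ∧
      σU (X (some c)) = X (some c) + X none * X (some b) ∧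
      σU (X (some d)) = X (some d) + X none * X (some c) ∧
      σU (X (some e)) = X (some e) + X none * X (some d) ∧
      ∀ i, i ≠ b → i ≠ c → i ≠ d → i ≠ e → σU (X (some i)) = X (some i) := by
  classical
  let s : MvPolynomial (Option (Fin n)) k := X none
  let Y : Fin n → MvPolynomial (Option (Fin n)) k := fun i => X (some i)
  let g : Option (Fin n) → MvPolynomial (Option (Fin n)) k := fun o =>
    match o with
    | none => s
    | some i => if i = b then Y b + s * Y a else if i = c then Y c + s * Y b
        else if i = d then Y d + s * Y c else if i = e then Y e + s * Y d else Y i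
  let g' : Option (Fin n) → MvPolynomial (Option (Fin n)) k := fun o =>
    match o with
    | none => s
    | some i => if i = b then Y b - s * Y a else if i = c then Y c - s * Y b + s ^ 2 * Y a
        else if i = d then Y d - s * Y c + s ^ 2 * Y b - s ^ 3 * Y a
        else if i = e then Y e - s * Y d + s ^ 2 * Y c - s ^ 3 * Y b + s ^ 4 * Y a else Y i
  set φ : MvPolynomial (Option (Fin n)) k →ₐ[k] MvPolynomial (Option (Fin n)) k := aeval g with hφ
  set ψ : MvPolynomial (Option (Fin n)) k →ₐ[k] MvPolynomial (Option (Fin n)) k := aeval g' with hψ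
  have hba : b ≠ a := fun h => hab h.symm
  have hca : c ≠ a := fun h => hac h.symm
  have hda : d ≠ a := fun h => had h.symm
  have hea : e ≠ a := fun h => hae h.symm
  have hcb : c ≠ b := fun h => hbc h.symm
  have hdb : d ≠ b := fun h => hbd h.symm
  have heb : e ≠ b := fun h => hbe h.symm
  have hdc : d ≠ c := fun h => hcd h.symm
  have hec : e ≠ c := fun h => hce h.symm
  have hed : e ≠ d := fun h => hde h.symm
  -- values of `φ`
  have φs : φ (X none) = s := by rw [hφ, aeval_X]
  have φa : φ (X (some a)) = Y a := by
    rw [hφ, aeval_X]; change (if a = b then _ else _) = _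
    rw [if_neg hab, if_neg hac, if_neg had, if_neg hae]
  have φb : φ (X (some b)) = Y b + s * Y a := by
    rw [hφ, aeval_X]; change (if b = b then _ else _) = _; rw [if_pos rfl]
  have φc : φ (X (some c)) = Y c + s * Y b := by
    rw [hφ, aeval_X]; change (if c = b then _ else _) = _; rw [if_neg hcb, if_pos rfl]
  have φd : φ (X (some d)) = Y d + s * Y c := by
    rw [hφ, aeval_X]; change (if d = b then _ else _) = _; rw [if_neg hdb, if_neg hdc, if_pos rfl]
  have φe : φ (X (some e)) = Y e + s * Y d := by
    rw [hφ, aeval_X]; change (if e = b then _ else _) = _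
    rw [if_neg heb, if_neg hec, if_neg hed, if_pos rfl]
  have φi : ∀ i, i ≠ b → i ≠ c → i ≠ d → i ≠ e → φ (X (some i)) = Y i := by
    intro i hib hic hid hie
    rw [hφ, aeval_X]; change (if i = b then _ else _) = _
    rw [if_neg hib, if_neg hic, if_neg hid, if_neg hie]
  -- values of `ψ`
  have ψs : ψ (X none) = s := by rw [hψ, aeval_X]
  have ψa : ψ (X (some a)) = Y a := by
    rw [hψ, aeval_X]; change (if a = b then _ else _) = _
    rw [if_neg hab, if_neg hac, if_neg had, if_neg hae]
  have ψb : ψ (X (some b)) = Y b - s * Y a := by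
    rw [hψ, aeval_X]; change (if b = b then _ else _) = _; rw [if_pos rfl]
  have ψc : ψ (X (some c)) = Y c - s * Y b + s ^ 2 * Y a := by
    rw [hψ, aeval_X]; change (if c = b then _ else _) = _; rw [if_neg hcb, if_pos rfl]
  have ψd : ψ (X (some d)) = Y d - s * Y c + s ^ 2 * Y b - s ^ 3 * Y a := by
    rw [hψ, aeval_X]; change (if d = b then _ else _) = _; rw [if_neg hdb, if_neg hdc, if_pos rfl]
  have ψe : ψ (X (some e)) = Y e - s * Y d + s ^ 2 * Y c - s ^ 3 * Y b + s ^ 4 * Y a := by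
    rw [hψ, aeval_X]; change (if e = b then _ else _) = _
    rw [if_neg heb, if_neg hec, if_neg hed, if_pos rfl]
  have ψi : ∀ i, i ≠ b → i ≠ c → i ≠ d → i ≠ e → ψ (X (some i)) = Y i := by
    intro i hib hic hid hie
    rw [hψ, aeval_X]; change (if i = b then _ else _) = _
    rw [if_neg hib, if_neg hic, if_neg hid, if_neg hie]
  have h₁ : φ.comp ψ = AlgHom.id k _ := by
    refine MvPolynomial.algHom_ext fun o => ?_
    change φ (ψ (X o)) = X o
    rcases o with _ | i
    · rw [ψs]; exact φs
    by_cases hib : i = b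
    · subst hib; rw [ψb, map_sub, map_mul, φb, φs, φa]; change _ = Y i; ring
    by_cases hic : i = c
    · subst hic; rw [ψc, map_add, map_sub, map_mul, map_mul, map_pow, φc, φb, φs, φa]
      change _ = Y i; ring
    by_cases hid : i = d
    · subst hid
      rw [ψd, map_sub, map_add, map_sub, map_mul, map_mul, map_mul, map_pow, map_pow, φd, φc, φb,
        φs, φa]
      change _ = Y i; ring
    by_cases hie : i = e
    · subst hie
      rw [ψe, map_add, map_sub, map_add, map_sub, map_mul, map_mul, map_mul, map_mul, map_pow,
        map_pow, map_pow, φe, φd, φc, φb, φs, φa]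
      change _ = Y i; ring
    · rw [ψi i hib hic hid hie]; exact φi i hib hic hid hie
  have h₂ : ψ.comp φ = AlgHom.id k _ := by
    refine MvPolynomial.algHom_ext fun o => ?_
    change ψ (φ (X o)) = X o
    rcases o with _ | i
    · rw [φs]; exact ψs
    by_cases hib : i = b
    · subst hib; rw [φb, map_add, map_mul, ψb, ψs, ψa]; change _ = Y i; ring
    by_cases hic : i = c
    · subst hic; rw [φc, map_add, map_mul, ψc, ψb, ψs]; change _ = Y i; ring
    by_cases hid : i = d
    · subst hid; rw [φd, map_add, map_mul, ψd, ψc, ψs]; change _ = Y i; ring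
    by_cases hie : i = e
    · subst hie; rw [φe, map_add, map_mul, ψe, ψd, ψs]; change _ = Y i; ring
    · rw [φi i hib hic hid hie]; exact ψi i hib hic hid hie
  refine ⟨AlgEquiv.ofAlgHom φ ψ h₁ h₂, φs, φb, φc, φd, φe, φi⟩

/-- **The deck involution exists as a `k`-algebra automorphism** of `k[s, Y, pass]`:
`s, Y₁, Y₃ ↦ −s, −Y₁, −Y₃`, all other variables fixed (its own inverse). [OURS · L1 W4.5c] -/
theorem exists_coverTau :
    ∃ τ : MvPolynomial (Option (Fin n)) k ≃ₐ[k] MvPolynomial (Option (Fin n)) k,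
      τ (X none) = -X none ∧ τ (X (some b)) = -X (some b) ∧ τ (X (some d)) = -X (some d) ∧
      (∀ i, i ≠ b → i ≠ d → τ (X (some i)) = X (some i)) ∧ ∀ y, τ (τ y) = y := by
  classical
  let g : Option (Fin n) → MvPolynomial (Option (Fin n)) k := fun o =>
    match o with
    | none => -X none
    | some i => if i = b then -X (some b) else if i = d then -X (some d) else X (some i)
  set φ : MvPolynomial (Option (Fin n)) k →ₐ[k] MvPolynomial (Option (Fin n)) k := aeval g with hφ
  have φs : φ (X none) = -X none := by rw [hφ, aeval_X]
  have φb : φ (X (some b)) = -X (some b) := by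
    rw [hφ, aeval_X]; change (if b = b then _ else _) = _; rw [if_pos rfl]
  have φd : φ (X (some d)) = -X (some d) := by
    rw [hφ, aeval_X]; change (if d = b then _ else _) = _
    by_cases hdb : d = b
    · rw [if_pos hdb, hdb]
    · rw [if_neg hdb, if_pos rfl]
  have φi : ∀ i, i ≠ b → i ≠ d → φ (X (some i)) = X (some i) := by
    intro i hib hid
    rw [hφ, aeval_X]; change (if i = b then _ else _) = _; rw [if_neg hib, if_neg hid]
  have h₁ : φ.comp φ = AlgHom.id k _ := by
    refine MvPolynomial.algHom_ext fun o => ?_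
    change φ (φ (X o)) = X o
    rcases o with _ | i
    · rw [φs, map_neg, φs, neg_neg]
    by_cases hib : i = b
    · subst hib; rw [φb, map_neg, φb, neg_neg]
    by_cases hid : i = d
    · subst hid; rw [φd, map_neg, φd, neg_neg]
    · rw [φi i hib hid, φi i hib hid]
  refine ⟨AlgEquiv.ofAlgHom φ φ h₁ h₁, φs, φb, φd, φi, fun y => ?_⟩
  exact congrArg (fun ψ : MvPolynomial (Option (Fin n)) k →ₐ[k] MvPolynomial (Option (Fin n)) k =>
    ψ y) h₁

end Summit.ResolutionOfSingularities.ResolutionOfSingularities.Theorems.WildQuotientResolution.JordanFive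

end
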